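import Summits.HodgeConjecture.HodgeConjecture.Theorems.F0LD1CharThetaSpaceLeOfIrreducible
import HarnessLib

-- As in the lineage: statements over the theta-kernel datum elaborate to very large types; elaborate sequentially.
set_option Elab.async false

/-!
# Crux `HLiu418`, organ A₂ `ThetaRealisation₂` (= LD1 (R)) — THE JUNCTION (A₂-J): «the theta space of the line `⟨a⟩` is NOT ORTHOGONAL to `P`»
# ⟹ «`P` MEETS the theta lift from `⟨a⟩`», by irreducibility of the character theta span and MULTIPLICITY ONE

Cell hodgecm-mathlib (D-0151), FLOOR 0; crux item `HLiu418` = stmt-HodgeConjecture-24832; organ A₂ of line LD2 (skeleton v5∕v7 `ThetaRealisation₂` :153) =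
organ (R) of line LD1 (`Lines/F0_P6LD_StubS1FactsThetaRoad.lean` ED. 1), single payer LD2-p02 (g0) (deal LD2-plan (g0) 2026-09-02T04:22:50Z; census
`F0/P6/LD/LD2-p02/g0/CENSUS-A2-ThetaRealisation2.v1.LD2-p02g0.md`).  THEOREMS ONLY (no `def`, no instance, no notation, no named fact, no `sorry`);
`--supports stmt-HodgeConjecture-24832 --as helper`.  Rank-generic `N`.

THE STEP.  [Liu2021, proof of Prop. 4.13 Case 1 ∕ proof of Prop. D.4 (1)]: after the pole theorem [Thm. B.4 (1)] has produced `Θ^W_{(μ,ν),V}(V_π) ≠ 0` for a LINE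
`W = ⟨a⟩` — in the tree's `L²` currency: the projection to `P` of SOME theta class `[Θ̃_Φ(f) ∘ ιA]` is non-zero (the input `hpr` below; this is the
conclusion of the letter (A₂-P)) — Liu invokes [Cor. B.6 (1)] + [(B.2)] «`V_π = Θ^V_{(μ⁻¹,ν⁻¹),−W}(Θ^W(V_π))`» to put theta lifts INSIDE `V_π`.  In house:
1. character detection (★ K1 `exists_charCM_of_apply_toLp_lineThetaLift_ne_zero`): `pr_P [Θ̃_Φ(charCM ξ) ∘ ιA] ≠ 0` for a character `ξ` of `[U(⟨a⟩)]`;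
2. the `(a, ξ)`-THETA SPAN `Q_ξ` (closure of the span of all `(a, ξ)`-classes) is a closed `R`-invariant subspace (★ (F1) `exists_closedSubrep_thetaSpan`,
   LD1-p01 (g0)) containing that class, hence `≠ ⊥`, hence TOPOLOGICALLY IRREDUCIBLE by the input `hIrr` (= the body of LD1's letter (F3)
   `Liu2021.ThetaLiftFromLineIrreducible` ∕ organ (I′) `ThetaSpaceIrreducible₂`, [Liu2021, Cor. B.6 (1)] = [Wu2013, Thm. 5.3]);
3. `Q_ξ` is not inside `Pᗮ`, so the compression of `pr_P` to `Q_ξ` is a non-zero intertwiner of irreducible unitary representations: ★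
   `ClosedSubrep.exists_le_orthogonal_areUnitarilyEquivalent` gives `W″ ≤ Pᗮᗮ = P` unitarily equivalent to `Q_ξ`; `W″` is irreducible
   (★ `isTopIrreducible_congr`) and non-zero, so `W″ = P` (★ `ClosedSubrep.eq_of_le_of_isTopIrreducible`): `Q_ξ ≃ᵤ P`;
4. MULTIPLICITY ONE for `L²([U(H)])` (input `hM1 : HasMultiplicityOne`; for the CM unitary curves = ★ letter `Rogawski1990.curveMultiplicityLeOne` through ★
   `hasMultiplicityOne_iff_multiplicity_le_one_holds`) ⇒ `Q_ξ = P`: the non-zero class `[Θ̃_Φ(charCM ξ) ∘ ιA]` lies IN `P` — `MeetsThetaLiftFromLine`.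

HONEST LABEL: HC_CM is proved only modulo the 7 printed citations (2 remaining: hLiu418 = stmt-HodgeConjecture-24832, h413 = stmt-HodgeConjecture-24833)
until rung 0 closes; this file discharges none of them (in-house junction toward organ A₂∕(R); its inputs `hM1`, `hIrr`, `hpr` are the letters' business).

## References
* [Liu2021] Y. Liu, Camb. J. Math. 9 (2021) = arXiv:2102.11518: proof of Prop. 4.13 Case 1 (l. 2129–2137, pp. 47–48); App. B Thm. B.4, Cor. B.6 (1)
  (pp. 98–99); App. D, proof of Prop. D.4 (1) (p. 130–131).
* [Wu2013] C. Wu, J. Number Theory 133 (2013), Thm. 5.3.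
* [Rogawski1990] J. Rogawski, Ann. of Math. Stud. 123 (1990), Thm. 13.3.6.
* [DeitmarEchterhoff2014] A. Deitmar, S. Echterhoff, 2nd ed., Cor. 6.1.9 (Schur for intertwiners of irreducible unitary representations).
* [Dixmier1977] J. Dixmier, *C\*-algebras*, §5.4, §13.1 (multiplicity).
-/

set_option autoImplicit false
-- the mandated namespace has the single-problem summit's repeated segment (`HodgeConjecture.HodgeConjecture`)
set_option linter.dupNamespace false

noncomputable section

open NumberField MeasureTheory IsDedekindDomain
open scoped Matrix ComplexOrder ENNReal

namespace Summit.HodgeConjecture.HodgeConjecture.Cruxes.HLiu418.F0LD2MeetsOfNonOrthogonal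

open _root_.MeasureTheory
open Literature.NumberTheory.Automorphic Literature.NumberTheory.Automorphic.UnitaryGroup
open Literature.NumberTheory.Automorphic.UnitaryGroup.CotangentForms
open Literature.NumberTheory.Automorphic.IdeleClassGroup
open Literature.NumberTheory.Automorphic.Liu2021
open Literature.NumberTheory.Automorphic.Liu2021.Def411WeilCarriers
open Literature.NumberTheory.Automorphic.Liu2021.Def411WeilCarriersDoubling
open Literature.NumberTheory.GelbartRogawski1991 Literature.NumberTheory.GelbartRogawski1991.UnitaryDualPair
open Literature.NumberTheory.Weil1964
open Literature.RepresentationTheory.Liu2021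
open Literature.RepresentationTheory.CompactGroups
open Summit.HodgeConjecture.HodgeConjecture.Cruxes.HLiu418.F0LD1ThetaTransportKit
open Summit.HodgeConjecture.HodgeConjecture.Cruxes.HLiu418.F0LD2FrameTransportPin
open Summit.HodgeConjecture.HodgeConjecture.Cruxes.HLiu418.F0LD1CharThetaSpaceLeOfIrreducible

variable (L : Type) [Field L] [NumberField L] [IsCMField L] (N : ℕ) (H : Matrix (Fin N) (Fin N) L)
  {n' : ℕ} (e₁ : Fin N × Fin 1 ≃ Fin n') (dV : Fin N → L) (hdV : ∀ i, IsCMField.complexConj L (dV i) = dV i)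
  (hdV0 : ∀ i, dV i ≠ 0) (t : L) (ht : t ≠ 0) (g : GL (Fin N) L)
  (hg : formCongr ((IsCMField.complexConj L : L ≃ₐ[(↥(maximalRealSubfield L))] L) : L →+* L) g (t • H) = Matrix.diagonal dV)
  (ιA : (adelicGroupData (↥(maximalRealSubfield L)) L (IsCMField.complexConj L) N H).Adelic →*
    ↥(UnitaryGroup.adelic (↥(maximalRealSubfield L)) L (IsCMField.complexConj L) N (Matrix.diagonal dV)))
  (hιA : ∀ k, ((ιA k : ↥(UnitaryGroup.adelic (↥(maximalRealSubfield L)) L (IsCMField.complexConj L) N (Matrix.diagonal dV))) :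
      GL (Fin N) (AdeleRing (𝓞 L) L)) =
    (toAdeleGL L g)⁻¹ * adelicVal (↥(maximalRealSubfield L)) L (IsCMField.complexConj L) N H k * toAdeleGL L g)
  [CompactSpace (↥(UnitaryGroup.adelic (↥(maximalRealSubfield L)) L (IsCMField.complexConj L) N (Matrix.diagonal dV)) ⧸
    (UnitaryGroup.toAdelic (↥(maximalRealSubfield L)) L (IsCMField.complexConj L) N (Matrix.diagonal dV)).range)]
  {μA : Measure (adelicGroupData (↥(maximalRealSubfield L)) L (IsCMField.complexConj L) N H).automorphicQuotient}
  [(adelicGroupData (↥(maximalRealSubfield L)) L (IsCMField.complexConj L) N H).IsAutomorphicMeasure μA]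
  [CompactSpace (adelicGroupData (↥(maximalRealSubfield L)) L (IsCMField.complexConj L) N H).automorphicQuotient]

include ht hg hιA

set_option maxHeartbeats 1600000 in
/-- **(A₂-J) NON-ORTHOGONALITY ⟹ MEETS.**  In the scaled rational frame `formCongr c g (t • H) = diag dV` with the pinned transport `ιA`
(`↑(ιA k) = g_𝔸⁻¹ k g_𝔸`), let `P` be a discrete automorphic representation of `U(H)` and `⟨a⟩` a hermitian line with the `μ`-splitting.  Assume:
`hM1` — MULTIPLICITY ONE in `L²([U(H)], μA)` (two unitarily equivalent irreducible closed invariant subspaces coincide; [Rogawski1990, Thm. 13.3.6] for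
the CM unitary curves, ★ letter `curveMultiplicityLeOne`); `hIrr` — for every character `ξ` of `[U(⟨a⟩)]` the closed `(a, ξ)`-theta span is `0` or
topologically irreducible (the body of ★ letter `Liu2021.ThetaLiftFromLineIrreducible`, [Liu2021, Cor. B.6 (1)] = [Wu2013, Thm. 5.3]); `hpr` — the
projection to `P` of SOME theta class `[Θ̃_Φ(f) ∘ ιA]` is non-zero ([Liu2021, Thm. B.4 (1)]: `Θ^W(V_π) ≠ 0`).  THEN `P` MEETS the theta lift from `⟨a⟩`
along `ιA` (★ `MeetsThetaLiftFromLine`: a non-zero theta class lies IN `P`).  Steps 1–4 of the module docstring.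
[cite: Liu2021, proof of Prop. 4.13 Case 1 (l. 2129–2137); App. B Cor. B.6 (1) (p. 99); App. D proof of Prop. D.4 (1) (p. 131)]
[cite: DeitmarEchterhoff2014, Cor. 6.1.9] [cite: Dixmier1977, §5.4] -/
theorem meetsThetaLiftFromLine_of_starProjection_ne_zero
    (P : DiscreteAutomorphicRep (adelicGroupData (↥(maximalRealSubfield L)) L (IsCMField.complexConj L) N H) μA)
    (μ : Literature.NumberTheory.Automorphic.IdeleClassGroup L →ₜ* Circle) (hμ : IsConjugateSymplectic L μ) (a : (↥(maximalRealSubfield L))ˣ)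
    (hM1 : ((adelicGroupData (↥(maximalRealSubfield L)) L (IsCMField.complexConj L) N H).rightRegular μA).HasMultiplicityOne)
    (hIrr : letI : MeasurableSpace (↥(UnitaryGroup.adelic (↥(maximalRealSubfield L)) L (IsCMField.complexConj L) 1 (JW (↥(maximalRealSubfield L)) L a)) ⧸
        (UnitaryGroup.toAdelic (↥(maximalRealSubfield L)) L (IsCMField.complexConj L) 1 (JW (↥(maximalRealSubfield L)) L a)).range) := borel _
      haveI := normal_range_toAdelic_JW L a
      ∀ (ξ : PontryaginDual (↥(UnitaryGroup.adelic (↥(maximalRealSubfield L)) L (IsCMField.complexConj L) 1 (JW (↥(maximalRealSubfield L)) L a)) ⧸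
          (UnitaryGroup.toAdelic (↥(maximalRealSubfield L)) L (IsCMField.complexConj L) 1 (JW (↥(maximalRealSubfield L)) L a)).range))
        (Q : ContRepresentation.ClosedSubrep ((adelicGroupData (↥(maximalRealSubfield L)) L (IsCMField.complexConj L) N H).rightRegular μA)),
        (Q.toSubmodule : Set ((adelicGroupData (↥(maximalRealSubfield L)) L (IsCMField.complexConj L) N H).L2 μA)) = closure (Submodule.span ℂ
            {v : (adelicGroupData (↥(maximalRealSubfield L)) L (IsCMField.complexConj L) N H).L2 μA | ∃ (hρ : HasThetaMajorants fun
          (p : ↥(UnitaryGroup.adelic (↥(maximalRealSubfield L)) L (IsCMField.complexConj L) N (Matrix.diagonal dV)) × ↥(UnitaryGroup.adelic (↥(maximalRealSubfield L)) L (IsCMField.complexConj L) 1 (JW (↥(maximalRealSubfield L)) L a))) (Φ : piSchwartzBruhat (↥(maximalRealSubfield L)) (Fin n')) =>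
            pairRep (↥(maximalRealSubfield L)) L (IsCMField.complexConj L) N 1 e₁ (Matrix.diagonal dV) (JW (↥(maximalRealSubfield L)) L a)
              (chiSplittingLine L e₁ dV hdV hdV0 (toHeckeCharacter L μ) (isUnitary_toHeckeCharacter L μ)
                ((isOscillatorChar_toHeckeCharacter_iff μ).mpr hμ) (TW (↥(maximalRealSubfield L)) a)
                (isUnit_det_TW (↥(maximalRealSubfield L)) a) (JW (↥(maximalRealSubfield L)) L a) (JW_eq (↥(maximalRealSubfield L)) L a))
              p Φ)
            (μW : Measure (↥(UnitaryGroup.adelic (↥(maximalRealSubfield L)) L (IsCMField.complexConj L) 1 (JW (↥(maximalRealSubfield L)) L a)) ⧸ (UnitaryGroup.toAdelic (↥(maximalRealSubfield L)) L (IsCMField.complexConj L) 1 (JW (↥(maximalRealSubfield L)) L a)).range)) (_ : IsFiniteMeasure μW)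
            (_ : SMulInvariantMeasure ↥(UnitaryGroup.adelic (↥(maximalRealSubfield L)) L (IsCMField.complexConj L) 1 (JW (↥(maximalRealSubfield L)) L a)) (↥(UnitaryGroup.adelic (↥(maximalRealSubfield L)) L (IsCMField.complexConj L) 1 (JW (↥(maximalRealSubfield L)) L a)) ⧸ (UnitaryGroup.toAdelic (↥(maximalRealSubfield L)) L (IsCMField.complexConj L) 1 (JW (↥(maximalRealSubfield L)) L a)).range) μW)
            (Ψ : piSchwartzBruhat (↥(maximalRealSubfield L)) (Fin n'))
            (hθ : MemLp (toQuotFun (adelicGroupData (↥(maximalRealSubfield L)) L (IsCMField.complexConj L) N H) fun x =>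
              (lineThetaKernelDatum L N e₁ dV hdV hdV0 μ hμ a hρ).thetaLiftFun μW Ψ (charCM ξ) (ιA x)) 2 μA),
            v = MemLp.toLp _ hθ} : Set ((adelicGroupData (↥(maximalRealSubfield L)) L (IsCMField.complexConj L) N H).L2 μA)) →
        Q.toSubmodule = ⊥ ∨ Q.toContRep.IsTopIrreducible)
    (hpr : letI : MeasurableSpace (↥(UnitaryGroup.adelic (↥(maximalRealSubfield L)) L (IsCMField.complexConj L) 1 (JW (↥(maximalRealSubfield L)) L a)) ⧸
        (UnitaryGroup.toAdelic (↥(maximalRealSubfield L)) L (IsCMField.complexConj L) 1 (JW (↥(maximalRealSubfield L)) L a)).range) := borel _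
      haveI := normal_range_toAdelic_JW L a
      ∃ (hρ : HasThetaMajorants fun
          (p : ↥(UnitaryGroup.adelic (↥(maximalRealSubfield L)) L (IsCMField.complexConj L) N (Matrix.diagonal dV)) × ↥(UnitaryGroup.adelic (↥(maximalRealSubfield L)) L (IsCMField.complexConj L) 1 (JW (↥(maximalRealSubfield L)) L a))) (Φ : piSchwartzBruhat (↥(maximalRealSubfield L)) (Fin n')) =>
            pairRep (↥(maximalRealSubfield L)) L (IsCMField.complexConj L) N 1 e₁ (Matrix.diagonal dV) (JW (↥(maximalRealSubfield L)) L a)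
              (chiSplittingLine L e₁ dV hdV hdV0 (toHeckeCharacter L μ) (isUnitary_toHeckeCharacter L μ)
                ((isOscillatorChar_toHeckeCharacter_iff μ).mpr hμ) (TW (↥(maximalRealSubfield L)) a)
                (isUnit_det_TW (↥(maximalRealSubfield L)) a) (JW (↥(maximalRealSubfield L)) L a) (JW_eq (↥(maximalRealSubfield L)) L a))
              p Φ)
        (μW : Measure (↥(UnitaryGroup.adelic (↥(maximalRealSubfield L)) L (IsCMField.complexConj L) 1 (JW (↥(maximalRealSubfield L)) L a)) ⧸ (UnitaryGroup.toAdelic (↥(maximalRealSubfield L)) L (IsCMField.complexConj L) 1 (JW (↥(maximalRealSubfield L)) L a)).range))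
        (_ : IsFiniteMeasure μW)
        (_ : SMulInvariantMeasure ↥(UnitaryGroup.adelic (↥(maximalRealSubfield L)) L (IsCMField.complexConj L) 1 (JW (↥(maximalRealSubfield L)) L a)) (↥(UnitaryGroup.adelic (↥(maximalRealSubfield L)) L (IsCMField.complexConj L) 1 (JW (↥(maximalRealSubfield L)) L a)) ⧸ (UnitaryGroup.toAdelic (↥(maximalRealSubfield L)) L (IsCMField.complexConj L) 1 (JW (↥(maximalRealSubfield L)) L a)).range) μW)
        (f : C((↥(UnitaryGroup.adelic (↥(maximalRealSubfield L)) L (IsCMField.complexConj L) 1 (JW (↥(maximalRealSubfield L)) L a)) ⧸ (UnitaryGroup.toAdelic (↥(maximalRealSubfield L)) L (IsCMField.complexConj L) 1 (JW (↥(maximalRealSubfield L)) L a)).range), ℂ))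
        (Φ : piSchwartzBruhat (↥(maximalRealSubfield L)) (Fin n'))
        (hθ : MemLp (toQuotFun (adelicGroupData (↥(maximalRealSubfield L)) L (IsCMField.complexConj L) N H) fun x =>
          (lineThetaKernelDatum L N e₁ dV hdV hdV0 μ hμ a hρ).thetaLiftFun μW Φ f (ιA x)) 2 μA),
        P.space.toSubmodule.starProjection (MemLp.toLp _ hθ) ≠ 0) :
    MeetsThetaLiftFromLine L N H e₁ dV hdV hdV0 P μ hμ a ιA := by
  letI : MeasurableSpace (↥(UnitaryGroup.adelic (↥(maximalRealSubfield L)) L (IsCMField.complexConj L) 1 (JW (↥(maximalRealSubfield L)) L a)) ⧸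
      (UnitaryGroup.toAdelic (↥(maximalRealSubfield L)) L (IsCMField.complexConj L) 1 (JW (↥(maximalRealSubfield L)) L a)).range) := borel _
  haveI : BorelSpace (↥(UnitaryGroup.adelic (↥(maximalRealSubfield L)) L (IsCMField.complexConj L) 1 (JW (↥(maximalRealSubfield L)) L a)) ⧸
      (UnitaryGroup.toAdelic (↥(maximalRealSubfield L)) L (IsCMField.complexConj L) 1 (JW (↥(maximalRealSubfield L)) L a)).range) := ⟨rfl⟩
  haveI := normal_range_toAdelic_JW L a
  -- the pinned transport is continuous and carries rational points to rational points
  have hιA' : Continuous ιA ∧ ∀ ⦃γ : (adelicGroupData (↥(maximalRealSubfield L)) L (IsCMField.complexConj L) N H).Adelic⦄,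
      γ ∈ (UnitaryGroup.toAdelic (↥(maximalRealSubfield L)) L (IsCMField.complexConj L) N H).range →
        ιA γ ∈ (UnitaryGroup.toAdelic (↥(maximalRealSubfield L)) L (IsCMField.complexConj L) N (Matrix.diagonal dV)).range :=
    ⟨continuous_of_pin L N H dV g ιA hιA, fun _ hγ => mem_range_toAdelic_of_pin L N H dV t ht g hg ιA hιA hγ⟩
  obtain ⟨hρ, μW, hfinW, hinvW, f, Φ, hθ, hne⟩ := hpr
  haveI : IsFiniteMeasure μW := hfinW
  haveI : SMulInvariantMeasure ↥(UnitaryGroup.adelic (↥(maximalRealSubfield L)) L (IsCMField.complexConj L) 1 (JW (↥(maximalRealSubfield L)) L a))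
      (↥(UnitaryGroup.adelic (↥(maximalRealSubfield L)) L (IsCMField.complexConj L) 1 (JW (↥(maximalRealSubfield L)) L a)) ⧸
        (UnitaryGroup.toAdelic (↥(maximalRealSubfield L)) L (IsCMField.complexConj L) 1 (JW (↥(maximalRealSubfield L)) L a)).range) μW := hinvW
  -- STEP 1: character detection through `pr_P` (the `MemLp` witness is proof-irrelevant: read it as the uniform one)
  have hne' : P.space.toSubmodule.starProjection
      (MemLp.toLp _ (memLp_toQuotFun_lineThetaLift L N H e₁ dV hdV hdV0 ιA hιA' μ hμ a hρ μW Φ f μA 2)) ≠ 0 := hne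
  obtain ⟨ξ, hξ⟩ := exists_charCM_of_apply_toLp_lineThetaLift_ne_zero L N H e₁ dV hdV hdV0 ιA hιA' μ hμ a hρ μW Φ f μA
    P.space.toSubmodule.starProjection hne'
  -- the detected character class `v`
  set v := MemLp.toLp _ (memLp_toQuotFun_lineThetaLift L N H e₁ dV hdV hdV0 ιA hιA' μ hμ a hρ μW Φ (charCM ξ) μA 2) with hvdef
  have hv : P.space.toSubmodule.starProjection v ≠ 0 := hξ
  have hv0 : v ≠ 0 := fun h0 => hv (by rw [h0, map_zero])
  -- STEP 2: the `(a, ξ)`-theta span `Q`, a closed invariant subspace containing `v`, irreducible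
  obtain ⟨Q, hQmem, hQcar⟩ := exists_closedSubrep_thetaSpan L N H e₁ dV hdV hdV0 t ht g hg ιA hιA (μA := μA) μ hμ a ξ
  have hvQ : v ∈ Q.toSubmodule := hQmem hρ μW hfinW hinvW Φ _
  have hQirr : Q.toContRep.IsTopIrreducible := by
    rcases hIrr ξ Q hQcar with hbot | hirr
    · exact absurd ((Submodule.mem_bot ℂ).1 (hbot ▸ hvQ)) hv0
    · exact hirr
  -- STEP 3: the compression of `pr_P` to `Q` — `Q` is unitarily equivalent to `P`
  have hR := (adelicGroupData (↥(maximalRealSubfield L)) L (IsCMField.complexConj L) N H).isUnitary_rightRegular μA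
  have hnot : ¬ Q ≤ P.space.orthogonal hR := by
    intro hle
    apply hv
    have hvorth : v ∈ P.space.toSubmoduleᗮ := hle hvQ
    exact (Submodule.starProjection_apply_eq_zero_iff _).2 hvorth
  obtain ⟨W'', hW''le, e, he⟩ :=
    ContRepresentation.ClosedSubrep.exists_le_orthogonal_areUnitarilyEquivalent hR (P.space.orthogonal hR) Q hQirr hnot
  rw [ContRepresentation.ClosedSubrep.orthogonal_orthogonal] at hW''le
  have hW''irr : W''.toContRep.IsTopIrreducible := (ContRepresentation.isTopIrreducible_congr e).1 hQirr
  have hW''nt : Nontrivial W''.toSubmodule := by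
    refine ⟨⟨e ⟨v, hvQ⟩, 0, fun h0 => hv0 ?_⟩⟩
    have h1 : (⟨v, hvQ⟩ : Q.toSubmodule) = 0 := EquivLike.injective e (by rw [h0, map_zero] : e ⟨v, hvQ⟩ = e 0)
    exact congrArg Subtype.val h1
  have hW''eq : W'' = P.space := ContRepresentation.ClosedSubrep.eq_of_le_of_isTopIrreducible P.irreducible hW''nt hW''le
  subst hW''eq
  -- STEP 4: multiplicity one
  have hQP : Q = P.space := hM1 Q P.space hQirr P.irreducible ⟨e, he⟩
  -- conclusion: the non-zero `(a, ξ)`-class `v` lies in `P`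
  exact ⟨hρ, μW, hfinW, hinvW, charCM ξ, Φ, _, hQP ▸ hvQ, hv0⟩

end Summit.HodgeConjecture.HodgeConjecture.Cruxes.HLiu418.F0LD2MeetsOfNonOrthogonal

end
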